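/-
Copyright (c) 2026. All rights reserved.
Released under Apache 2.0 license as described in the file LICENSE.
-/
import Literature.NumberTheory.Automorphic.ArchimedeanSecondKindChart
import Literature.RepresentationTheory.KonnoKonno2007.JunctionLinearRealGroup
import Literature.RepresentationTheory.KonnoKonno2007.JunctionSmoothOneParameter
import Literature.RepresentationTheory.KonnoKonno2007.JunctionHyperbolicVacuumPin
import Literature.RepresentationTheory.KonnoKonno2007.RealUnitaryDualPairBallFrame
import Literature.AlgebraicGeometry.ShimuraVarieties.UnitaryBallCauchyRiemann
import HarnessLib

/-!
# Smoothness of an archimedean Weil datum along `U(2,1)`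

Topic `RepresentationTheory/KonnoKonno2007`. Let `ω` be an archimedean Weil datum of the real unitary dual
pair `G_∞ = U(2,1) × U(R,S)` (`RealUnitaryDualPair.Ginf (Fin 2) Unit R S`, Konno–Konno 2007 §3.1) on the
Schwartz space `𝓢 = 𝓢(ℝ^{DPIdx}, ℂ)` (`IsArchWeilDatum`, Folland 1989 §4.2), whose maximal compact
`K × K′` acts on the vacuum by the scalar `vacScalar e` (hypothesis `hvac`, the vacuum clause of
`JunctionDegreeOneKTypes`). The main theorem of this file (`contDiffAt_weilDatum_inl`) is:

  for every map `c : B → U(2,1)` from a real normed space which is `C^∞` at `x₀` as a matrix-valued map,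
  every continuous `ℝ`-linear map `T : 𝓢 → V` into a real normed space and every `Φ ∈ 𝓢`, the function
  `x ↦ T (ω (c x, 1) Φ)` is `C^∞` at `x₀`.

In particular (`contDiffAt_weilDatum_mul_expP`, `differentiableAt_weilDatum_mul_expP`, `contDiff_weilDatum_expP`,
`differentiableAt_weilDatum_expP`), in the ball model
`U21` of `UnitaryBallU21` carried to the junction frame by `u21FrameEquiv` (`RealUnitaryDualPairBallFrame`),
`b ↦ T (ω (u21FrameEquiv (y · expP b), 1) Φ)` is `C^∞`, hence real-Fréchet-differentiable, at every
`b ∈ ℂ²` for every `y ∈ U(2,1)` — the differentiability input of the first-order holomorphy criterion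
`UnitaryBallHolomorphyCriterion` for theta lifts.

## The argument

§1 is generic: `H` is a linear real group with full Lie algebra `𝔤` over a finite-dimensional coefficient
algebra (`RealMatrixGroups`, hypothesis `hreg` of `ArchimedeanCalculusRegular`), `X₀, …, X_{d-1}` have the
same matrices as an `ℝ`-basis `b` of `𝔤`, and `ρ` is a homomorphism from `H` to the linear endomorphisms
of a Schwartz space `𝓢(D, ℂ)` whose one-parameter groups along the `Xᵢ` are *smooth letters*
`s ↦ ρ (exp (s Xᵢ)) = ℓᵢ.op s = preᵢ ∘ famᵢ (s) ∘ postᵢ` (`SchwartzOneParameterWords.SmoothLetter`: a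
fixed operator, a one-parameter family with locally uniform Schwartz-seminorm bounds and a generator, a
fixed operator). Along the ordered product of one-parameter subgroups `Ψ (t) = ∏ exp (tᵢ Xᵢ)`
(`RealMatrixGroup.skProd`) such a `ρ` acts by the word operator `wordOp d ℓ t`
(`apply_skProd_eq_wordOp`), which is jointly `C^∞` in `t` on every vector after every real functional
(`contDiffAt_wordOp_comp`, the engine). In canonical coordinates of the second kind `τ` around `1`
(`RealMatrixGroup.exists_secondKindCoords`: `Ψ (τ h) = h` near `1`, `τ` smooth at `1`; Varadarajan 1984,
Thm. 2.10.1) one has, for `x` near `x₀` and `g₀ = c x₀`,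

  `ρ (c x) Φ = ρ (c x · g₀⁻¹) (ρ g₀ Φ) = wordOp d ℓ (τ (c x · g₀⁻¹)) (ρ g₀ Φ)`,

and `x ↦ τ (c x · g₀⁻¹)` is `C^∞` at `x₀` (chain rule); this is `RealMatrixGroup.contDiffAt_apply_of_letters`.

§2 supplies the letters of `U(2,1)`: by the exponential table of the adapted basis of `𝔲(2,1)`
(`JunctionLinearRealGroup.expMem_smul_u21AdaptedBasis`: `exp (s Xᵢ) = kᵢ Lᵢ(s) kᵢ⁻¹` with `kᵢ ∈ K` and
`Lᵢ` a boost `hypV p ()` or a compact torus), and by the pinned actions of an archimedean Weil datum — on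
`K × K′` by `κOp e` (`weilDatum_apply_κ_eq_κOp`, Folland 1989 Prop. (4.39)), on compact tori by `torusKOp`
(`weilDatum_apply_κ_torusK`) and on boosts by the hyperbolic family `hypOp` (`weilDatum_apply_hypV_eq_hypOp`,
Folland 1989 (4.24)) — each `s ↦ ω (exp (s Xᵢ), 1)` is the smooth letter `letterOp e kᵢ (kindᵢ)`
(`weilDatum_apply_conj_letterOf`; smoothness of the families: `isSmoothOneParam_hypOp`,
`isSmoothOneParam_torusKOp` of `JunctionSmoothOneParameter`). §3 assembles the main theorem over the linear
real group `uFormGroup (Fin 2) Unit` (`JunctionLinearRealGroup`, regular by `uFormGroup_regular`) and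
transports it to the ball model (`coe_u21FrameEquiv`, `mat_expP`).

(H1) Everything here is kernel-proved; the hypotheses are `IsArchWeilDatum` and the vacuum clause `hvac`,
exactly as in `JunctionSmoothOneParameter`/`JunctionHyperbolicVacuumPin`. (H2) Smoothness hypotheses on
matrix-valued maps refer to the `Matrix.Norms.Operator` instances (convention of
`ArchimedeanSecondKindChart`, `UnitaryBallCauchyRiemann`); the conclusions of §3 for the ball model are
norm-free. (H3) No continuity of `g ↦ ω g Φ` beyond the pinned one-parameter families is used.
-/

noncomputable section

open scoped MatrixGroups Matrix Topology SchwartzMap Matrix.Norms.Operator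
open Filter
open Literature.NumberTheory.Automorphic Literature.Analysis.SegalBargmann Literature.NumberTheory.Weil1964

-- the commutator bracket on matrices, as in `Literature.NumberTheory.Automorphic.RealMatrixGroups`
attribute [local instance 100] LieRing.ofAssociativeRing

/-! ## 1. Generic: smoothness of `x ↦ T (ρ (c x) Φ)` from smooth letters along a basis -/

namespace Literature.NumberTheory.Automorphic

namespace RealMatrixGroup

section Generic

open scoped ContDiff

variable {A : Type*} [NormedCommRing A] [NormedAlgebra ℝ A] [NormedAlgebra ℚ A] [CompleteSpace A] [StarRing A]
  {N : Type*} [Fintype N] [DecidableEq N] (H : RealMatrixGroup A N)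
  {D : Type*} [NormedAddCommGroup D] [NormedSpace ℝ D]
  {V : Type*} [NormedAddCommGroup V] [NormedSpace ℝ V]

/-- **A representation with smooth letters acts along `Ψ_X` by the word operator**: if
`ρ (exp (s Xᵢ)) = ℓᵢ.op s` for all `i`, `s`, then `ρ (Ψ_X (t)) f = wordOp d ℓ t f`. [folklore] -/
theorem apply_skProd_eq_wordOp (ρ : H.carrier →* (𝓢(D, ℂ) →ₗ[ℂ] 𝓢(D, ℂ))) :
    ∀ (d : ℕ) (X : Fin d → H.lie) (ℓ : Fin d → SmoothLetter D)
      (_ : ∀ (i : Fin d) (s : ℝ) (f : 𝓢(D, ℂ)), ρ (H.expMem (s • X i)) f = (ℓ i).op s f)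
      (t : Fin d → ℝ) (f : 𝓢(D, ℂ)), ρ (H.skProd d X t) f = wordOp d ℓ t f
  | 0, X, ℓ, _, t, f => by
    rw [skProd_zero_left, map_one, wordOp_zero]
    rfl
  | d + 1, X, ℓ, hρ, t, f => by
    rw [skProd_succ, map_mul, Module.End.mul_apply, hρ 0 (t 0), wordOp_succ_apply,
      apply_skProd_eq_wordOp ρ d (Fin.tail X) (Fin.tail ℓ) (fun i => hρ i.succ) (Fin.tail t) f]

set_option backward.isDefEq.respectTransparency false in
/-- **Smoothness from smooth letters (generic).** Let `H` have full Lie algebra `𝔤` over a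
finite-dimensional coefficient algebra, let `X₀, …, X_{d-1} ∈ 𝔤` have the matrices of an `ℝ`-basis `b` of
`𝔤`, and let `ρ : H →* End (𝓢(D, ℂ))` act along each `s ↦ exp (s Xᵢ)` by a smooth letter `ℓᵢ`. Then for
every `c : B → H`, `C^∞` at `x₀` as a matrix-valued map, every continuous real-linear `T : 𝓢(D, ℂ) → V` and
every `Φ`, `x ↦ T (ρ (c x) Φ)` is `C^∞` at `x₀`. (Canonical coordinates of the second kind,
`exists_secondKindCoords`, and the chain rule `contDiffAt_wordOp_comp`.)
[cite: Varadarajan1984, Thm. 2.10.1 and (2.10.19), p. 89] -/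
theorem contDiffAt_apply_of_letters [FiniteDimensional ℝ A]
    (hreg : ∀ X : Matrix N N A, (∀ t : ℝ, expGL (t • X) ∈ H.carrier) → X ∈ H.lie)
    {d : ℕ} (X : Fin d → H.lie) (b : Module.Basis (Fin d) ℝ H.lie.toSubmodule)
    (hXb : ∀ i, (X i : Matrix N N A) = (b i : Matrix N N A))
    (ρ : H.carrier →* (𝓢(D, ℂ) →ₗ[ℂ] 𝓢(D, ℂ))) (ℓ : Fin d → SmoothLetter D)
    (hρ : ∀ (i : Fin d) (s : ℝ) (f : 𝓢(D, ℂ)), ρ (H.expMem (s • X i)) f = (ℓ i).op s f)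
    {B : Type*} [NormedAddCommGroup B] [NormedSpace ℝ B] {c : B → H.carrier} {x₀ : B}
    (hc : ContDiffAt ℝ ∞ (fun x => ((c x : GL N A) : Matrix N N A)) x₀)
    (T : 𝓢(D, ℂ) →L[ℝ] V) (Φ : 𝓢(D, ℂ)) :
    ContDiffAt ℝ ∞ (fun x => T (ρ (c x) Φ)) x₀ := by
  obtain ⟨τ, hτ, -, hchart⟩ := H.exists_secondKindCoords hreg b
  have hXeq : (fun i => (⟨(b i : Matrix N N A), (b i).2⟩ : H.lie)) = X :=
    funext fun i => Subtype.ext (hXb i).symm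
  rw [hXeq] at hchart
  -- the recentred curve `u x = c x · g₀⁻¹`, `g₀ = c x₀`
  set g₀ : H.carrier := c x₀ with hg₀_def
  have hcoe : (fun x => (((c x * g₀⁻¹ : H.carrier) : GL N A) : Matrix N N A)) =
      fun x => ((c x : GL N A) : Matrix N N A) * (((g₀⁻¹ : H.carrier) : GL N A) : Matrix N N A) := by
    funext x
    rw [Subgroup.coe_mul, Units.val_mul]
  have hu : ContDiffAt ℝ ∞ (fun x => (((c x * g₀⁻¹ : H.carrier) : GL N A) : Matrix N N A)) x₀ := by
    rw [hcoe]
    exact hc.mul contDiffAt_const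
  have hut : Tendsto (fun x => (c x * g₀⁻¹ : H.carrier)) (𝓝 x₀) (𝓝 1) := by
    have h := (H.continuousAt_of_coe hu.continuousAt).tendsto
    rwa [hg₀_def, mul_inv_cancel] at h
  -- near `x₀`: `Ψ_X (τ (u x)) = u x`, hence `ρ (c x) Φ = wordOp d ℓ (τ (u x)) (ρ g₀ Φ)`
  have hEq : (fun x => T (ρ (c x) Φ)) =ᶠ[𝓝 x₀]
      fun x => T (wordOp d ℓ (τ (((c x * g₀⁻¹ : H.carrier) : GL N A) : Matrix N N A)) (ρ g₀ Φ)) := by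
    filter_upwards [hut.eventually hchart] with x hx
    rw [← H.apply_skProd_eq_wordOp ρ d X ℓ hρ, hx, ← Module.End.mul_apply, ← map_mul,
      inv_mul_cancel_right]
  refine ContDiffAt.congr_of_eventuallyEq ?_ hEq
  have hτ' : ContDiffAt ℝ ∞ τ (((c x₀ * g₀⁻¹ : H.carrier) : GL N A) : Matrix N N A) := by
    rw [hg₀_def, mul_inv_cancel, show (((1 : H.carrier) : GL N A) : Matrix N N A) = 1 from rfl]
    exact hτ
  exact contDiffAt_wordOp_comp d ℓ T (ρ g₀ Φ) le_rfl (hτ'.comp x₀ hu)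

end Generic

end RealMatrixGroup

end Literature.NumberTheory.Automorphic

/-! ## 2. The letters of `U(2,1)` under an archimedean Weil datum -/

namespace Literature.RepresentationTheory.KonnoKonno2007

namespace RealDualPair

local notation "SR" σ => SchwartzMap (σ → ℝ) ℂ

section Letters

variable {R S : Type*} [Fintype R] [DecidableEq R] [Fintype S] [DecidableEq S]

variable (R S) in
/-- **The smooth letter of a framed generator**: for a frame `k ∈ U(2) × U(1)` and a letter kind,
`boost p ↦ (κOp e (k,1), hypOp p (), its generator, κOp e (k⁻¹,1))`,
`torus a b ↦ (κOp e (k,1), torusKOp e a b, torusKGen e a b, κOp e (k⁻¹,1))`.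
[cite: Folland1989, (4.24), Prop. (4.39)] -/
def letterOp (e : VacExponents) (k : Matrix.unitaryGroup (Fin 2) ℂ × Matrix.unitaryGroup Unit ℂ) :
    LetterKind → SmoothLetter (DPIdx (Fin 2) Unit R S → ℝ)
  | .boost p => ⟨κOp R S e (k, 1), hypOp R S p (), hypOpGenC R S p (), κOp R S e (k⁻¹, 1),
      isSmoothOneParam_hypOp R S p ()⟩
  | .torus a b => ⟨κOp R S e (k, 1), torusKOp R S e a b, torusKGen R S e a b, κOp R S e (k⁻¹, 1),
      isSmoothOneParam_torusKOp e a b⟩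

/-- The operator of a boost letter: `κOp e (k,1) ∘ hypOp p () s ∘ κOp e (k⁻¹,1)`. [folklore] -/
@[simp] theorem letterOp_boost_op (e : VacExponents)
    (k : Matrix.unitaryGroup (Fin 2) ℂ × Matrix.unitaryGroup Unit ℂ) (p : Fin 2) (s : ℝ)
    (f : SR (DPIdx (Fin 2) Unit R S)) :
    (letterOp R S e k (.boost p)).op s f = κOp R S e (k, 1) (hypOp R S p () s (κOp R S e (k⁻¹, 1) f)) :=
  rfl

/-- The operator of a torus letter: `κOp e (k,1) ∘ torusKOp e a b s ∘ κOp e (k⁻¹,1)`. [folklore] -/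
@[simp] theorem letterOp_torus_op (e : VacExponents)
    (k : Matrix.unitaryGroup (Fin 2) ℂ × Matrix.unitaryGroup Unit ℂ) (a : Fin 2 → ℝ) (b : Unit → ℝ)
    (s : ℝ) (f : SR (DPIdx (Fin 2) Unit R S)) :
    (letterOp R S e k (.torus a b)).op s f =
      κOp R S e (k, 1) (torusKOp R S e a b s (κOp R S e (k⁻¹, 1) f)) :=
  rfl

/-- `κ (k, 1) = (kV k, 1)` in `G_∞`. [folklore] -/
theorem κ_mk_one {P Q : Type*} [Fintype P] [DecidableEq P] [Fintype Q] [DecidableEq Q]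
    (k : Matrix.unitaryGroup P ℂ × Matrix.unitaryGroup Q ℂ) :
    κ P Q R S (k, 1) = ((UForm.kV P Q k, (1 : UForm R S)) : Ginf P Q R S) :=
  Prod.ext rfl (map_one (UForm.kV R S))

/-- **A conjugated letter acts by its smooth letter**: for an archimedean Weil datum with vacuum clause,
`ω (k L(s) k⁻¹, 1) f = (letterOp e k kind).op s f` for `k = kV (frame)` and `L = letterOf kind`.
[cite: Folland1989, (4.24), Prop. (4.39)] -/
theorem weilDatum_apply_conj_letterOf {ω : Representation ℂ (Ginf (Fin 2) Unit R S) (SR (DPIdx (Fin 2) Unit R S))}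
    (hW : IsArchWeilDatum (ι𝕎 (Fin 2) Unit R S) ω) {e : VacExponents}
    (hvac : ∀ k : DPK (Fin 2) Unit R S, ω (κ (Fin 2) Unit R S k) (hermitePi 0) = vacScalar e k • hermitePi 0)
    (k : Matrix.unitaryGroup (Fin 2) ℂ × Matrix.unitaryGroup Unit ℂ) (kd : LetterKind) (s : ℝ)
    (f : SR (DPIdx (Fin 2) Unit R S)) :
    ω ((UForm.kV (Fin 2) Unit k * letterOf kd s * (UForm.kV (Fin 2) Unit k)⁻¹, (1 : UForm R S)) :
        Ginf (Fin 2) Unit R S) f =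
      (letterOp R S e k kd).op s f := by
  have hk2 : κ (Fin 2) Unit R S (k⁻¹, 1) = (((UForm.kV (Fin 2) Unit k)⁻¹, (1 : UForm R S)) : Ginf (Fin 2) Unit R S) :=
    Prod.ext (map_inv (UForm.kV (Fin 2) Unit) k) (map_one (UForm.kV R S))
  have h1 : ((UForm.kV (Fin 2) Unit k * letterOf kd s * (UForm.kV (Fin 2) Unit k)⁻¹, (1 : UForm R S)) :
        Ginf (Fin 2) Unit R S) =
      κ (Fin 2) Unit R S (k, 1) * ((letterOf kd s, (1 : UForm R S)) : Ginf (Fin 2) Unit R S) *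
        κ (Fin 2) Unit R S (k⁻¹, 1) := by
    rw [κ_mk_one, hk2, Prod.mk_mul_mk, Prod.mk_mul_mk, mul_one, mul_one]
  rw [h1, map_mul, map_mul, Module.End.mul_apply, Module.End.mul_apply,
    weilDatum_apply_κ_eq_κOp hW hvac (k⁻¹, 1) f, weilDatum_apply_κ_eq_κOp hW hvac (k, 1)]
  cases kd with
  | boost p =>
    rw [letterOp_boost_op, letterOf_boost, weilDatum_apply_hypV_eq_hypOp hW p () s]
  | torus a b =>
    have h2 : ((letterOf (.torus a b) s, (1 : UForm R S)) : Ginf (Fin 2) Unit R S) =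
        κ (Fin 2) Unit R S (torusK R S a b s) :=
      Prod.ext rfl (map_one (UForm.kV R S)).symm
    rw [letterOp_torus_op, h2, weilDatum_apply_κ_torusK hW hvac a b s]

end Letters

/-! ## 3. The main theorem and its ball-model form -/

section Main

variable {R S : Type*} [Fintype R] [DecidableEq R] [Fintype S] [DecidableEq S]
  {V : Type*} [NormedAddCommGroup V] [NormedSpace ℝ V]

/-- **The adapted basis vectors of `𝔲(2,1)` as elements of the Lie algebra** (same matrices as
`u21AdaptedBasis`). [folklore] -/
def u21X (i : Fin 9) : (uFormGroup (Fin 2) Unit).lie :=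
  ⟨((u21AdaptedBasis i : (uFormGroup (Fin 2) Unit).lie.toSubmodule) : Matrix (Fin 2 ⊕ Unit) (Fin 2 ⊕ Unit) ℂ),
    (u21AdaptedBasis i).2⟩

/-- `u21X i` and `u21AdaptedBasis i` have the same matrix. [folklore] -/
@[simp] theorem coe_u21X (i : Fin 9) :
    (u21X i : Matrix (Fin 2 ⊕ Unit) (Fin 2 ⊕ Unit) ℂ) =
      ((u21AdaptedBasis i : (uFormGroup (Fin 2) Unit).lie.toSubmodule) : Matrix (Fin 2 ⊕ Unit) (Fin 2 ⊕ Unit) ℂ) :=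
  rfl

/-- **The exponential table along `u21X`**: `exp (s · u21X i) = kV (kᵢ) · letterOf (kindᵢ) s · kV (kᵢ)⁻¹`
(`expMem_smul_u21AdaptedBasis`). [folklore] -/
theorem expMem_smul_u21X (i : Fin 9) (s : ℝ) :
    (uFormGroup (Fin 2) Unit).expMem (s • u21X i) =
      UForm.kV (Fin 2) Unit (u21FrameK i) * letterOf (u21Kind i) s * (UForm.kV (Fin 2) Unit (u21FrameK i))⁻¹ :=
  expMem_smul_u21AdaptedBasis i s

variable {P Q : Type*} [Fintype P] [DecidableEq P] [Fintype Q] [DecidableEq Q]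

variable (R S) in
/-- **`g ↦ ω (g, 1)`**: the restriction of a representation of `G_∞ = U(P,Q) × U(R,S)` to the first factor,
as a homomorphism from the carrier of the linear real group `uFormGroup P Q`. [folklore] -/
def inlRep (ω : Representation ℂ (Ginf P Q R S) (SR (DPIdx P Q R S))) :
    (uFormGroup P Q).carrier →* ((SR (DPIdx P Q R S)) →ₗ[ℂ] SR (DPIdx P Q R S)) :=
  ω.comp (MonoidHom.inl (UForm P Q) (UForm R S))

/-- `inlRep ω g = ω (g, 1)`. [folklore] -/
@[simp] theorem inlRep_apply (ω : Representation ℂ (Ginf P Q R S) (SR (DPIdx P Q R S))) (g : UForm P Q) :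
    inlRep R S ω g = ω ((g, (1 : UForm R S)) : Ginf P Q R S) := rfl

set_option backward.isDefEq.respectTransparency false in
/-- **Smoothness of an archimedean Weil datum along `U(2,1)`.** For an archimedean Weil datum `ω` of
`U(2,1) × U(R,S)` with vacuum clause, every `c : B → U(2,1)` which is `C^∞` at `x₀` as a matrix-valued map,
every continuous real-linear `T : 𝓢 → V` and every `Φ ∈ 𝓢`, the function `x ↦ T (ω (c x, 1) Φ)` is `C^∞`
at `x₀`. [cite: Varadarajan1984, Thm. 2.10.1 and (2.10.19), p. 89] -/
theorem contDiffAt_weilDatum_inl {ω : Representation ℂ (Ginf (Fin 2) Unit R S) (SR (DPIdx (Fin 2) Unit R S))}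
    (hW : IsArchWeilDatum (ι𝕎 (Fin 2) Unit R S) ω) {e : VacExponents}
    (hvac : ∀ k : DPK (Fin 2) Unit R S, ω (κ (Fin 2) Unit R S k) (hermitePi 0) = vacScalar e k • hermitePi 0)
    {B : Type*} [NormedAddCommGroup B] [NormedSpace ℝ B] {c : B → UForm (Fin 2) Unit} {x₀ : B}
    (hc : ContDiffAt ℝ ((⊤ : ℕ∞) : WithTop ℕ∞)
      (fun x => ((c x : GL (Fin 2 ⊕ Unit) ℂ) : Matrix (Fin 2 ⊕ Unit) (Fin 2 ⊕ Unit) ℂ)) x₀)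
    (T : (SR (DPIdx (Fin 2) Unit R S)) →L[ℝ] V) (Φ : SR (DPIdx (Fin 2) Unit R S)) :
    ContDiffAt ℝ ((⊤ : ℕ∞) : WithTop ℕ∞) (fun x => T (ω ((c x, (1 : UForm R S)) : Ginf (Fin 2) Unit R S) Φ)) x₀ :=
  (uFormGroup (Fin 2) Unit).contDiffAt_apply_of_letters uFormGroup_regular u21X u21AdaptedBasis (fun _ => rfl)
    (inlRep R S ω) (fun i => letterOp R S e (u21FrameK i) (u21Kind i))
    (fun i s f => by
      rw [expMem_smul_u21X]
      exact weilDatum_apply_conj_letterOf hW hvac (u21FrameK i) (u21Kind i) s f)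
    hc T Φ

open Literature.Geometry.ComplexHyperbolic.BallModel Literature.AlgebraicGeometry.ShimuraVarieties.BallForms

set_option backward.isDefEq.respectTransparency false in
/-- **Ball-model form.** For `c : B → U21` (the ball model's `U(2,1) ≤ GL₃(ℂ)`), `C^∞` at `x₀` as a
matrix-valued map, `x ↦ T (ω (u21FrameEquiv (c x), 1) Φ)` is `C^∞` at `x₀` (the frame `u21FrameEquiv` is a
reindexing of matrices, `coe_u21FrameEquiv`). [folklore] -/
theorem contDiffAt_weilDatum_ball {ω : Representation ℂ (Ginf (Fin 2) Unit R S) (SR (DPIdx (Fin 2) Unit R S))}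
    (hW : IsArchWeilDatum (ι𝕎 (Fin 2) Unit R S) ω) {e : VacExponents}
    (hvac : ∀ k : DPK (Fin 2) Unit R S, ω (κ (Fin 2) Unit R S k) (hermitePi 0) = vacScalar e k • hermitePi 0)
    {B : Type*} [NormedAddCommGroup B] [NormedSpace ℝ B] {c : B → U21} {x₀ : B}
    (hc : ContDiffAt ℝ ((⊤ : ℕ∞) : WithTop ℕ∞) (fun x => mat (c x)) x₀)
    (T : (SR (DPIdx (Fin 2) Unit R S)) →L[ℝ] V) (Φ : SR (DPIdx (Fin 2) Unit R S)) :
    ContDiffAt ℝ ((⊤ : ℕ∞) : WithTop ℕ∞)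
      (fun x => T (ω ((u21FrameEquiv (c x), (1 : UForm R S)) : Ginf (Fin 2) Unit R S) Φ)) x₀ := by
  refine contDiffAt_weilDatum_inl hW hvac ?_ T Φ
  have hfun : (fun x => (((u21FrameEquiv (c x) : UForm (Fin 2) Unit) : GL (Fin 2 ⊕ Unit) ℂ) :
      Matrix (Fin 2 ⊕ Unit) (Fin 2 ⊕ Unit) ℂ)) = fun x => Matrix.reindex frameIdx frameIdx (mat (c x)) :=
    funext fun x => coe_u21FrameEquiv (c x)
  -- reindexing is a continuous linear map for the operator norms (finite dimension)
  have hL : ContDiff ℝ ((⊤ : ℕ∞) : WithTop ℕ∞)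
      (fun M : Matrix (Fin 3) (Fin 3) ℂ => Matrix.reindex frameIdx frameIdx M) := by
    let L : Matrix (Fin 3) (Fin 3) ℂ →ₗ[ℝ] Matrix (Fin 2 ⊕ Unit) (Fin 2 ⊕ Unit) ℂ :=
      (Matrix.reindexLinearEquiv ℝ ℂ frameIdx frameIdx).toLinearMap
    have hLc : Continuous L := L.continuous_of_finiteDimensional
    have hco : ⇑(⟨L, hLc⟩ : Matrix (Fin 3) (Fin 3) ℂ →L[ℝ] Matrix (Fin 2 ⊕ Unit) (Fin 2 ⊕ Unit) ℂ) =
        fun M => Matrix.reindex frameIdx frameIdx M := rfl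
    rw [← hco]
    exact ContinuousLinearMap.contDiff _
  rw [hfun]
  exact hL.contDiffAt.comp x₀ hc

set_option backward.isDefEq.respectTransparency false in
/-- **Smoothness in the exponential `𝔭`-coordinates of the ball**: for every `y ∈ U(2,1)` and every `b₀`,
`b ↦ T (ω (u21FrameEquiv (y · expP b), 1) Φ)` is `C^∞` at `b₀`. [folklore] -/
theorem contDiffAt_weilDatum_mul_expP
    {ω : Representation ℂ (Ginf (Fin 2) Unit R S) (SR (DPIdx (Fin 2) Unit R S))}
    (hW : IsArchWeilDatum (ι𝕎 (Fin 2) Unit R S) ω) {e : VacExponents}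
    (hvac : ∀ k : DPK (Fin 2) Unit R S, ω (κ (Fin 2) Unit R S k) (hermitePi 0) = vacScalar e k • hermitePi 0)
    (y : U21) (T : (SR (DPIdx (Fin 2) Unit R S)) →L[ℝ] V) (Φ : SR (DPIdx (Fin 2) Unit R S)) (b₀ : Fin 2 → ℂ) :
    ContDiffAt ℝ ((⊤ : ℕ∞) : WithTop ℕ∞)
      (fun b : Fin 2 → ℂ => T (ω ((u21FrameEquiv (y * expP b), (1 : UForm R S)) : Ginf (Fin 2) Unit R S) Φ))
      b₀ := by
  refine contDiffAt_weilDatum_ball hW hvac ?_ T Φ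
  have hfun : (fun b : Fin 2 → ℂ => mat (y * expP b)) = fun b => mat y * NormedSpace.exp (pMatL b) := by
    funext b
    rw [mat_mul, mat_expP, pMatL_apply]
  rw [hfun]
  exact contDiffAt_const.mul
    ((NormedSpace.exp_analytic (𝕂 := ℝ) (pMatL b₀)).contDiffAt.comp b₀ pMatL.contDiff.contDiffAt)

/-- **Differentiability in the exponential `𝔭`-coordinates** (the differentiability input `hd` of the
first-order holomorphy criterion `UnitaryBallHolomorphyCriterion`): `b ↦ T (ω (u21FrameEquiv (y · expP b), 1) Φ)`
is real-Fréchet-differentiable at every `b₀`. [folklore] -/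
theorem differentiableAt_weilDatum_mul_expP
    {ω : Representation ℂ (Ginf (Fin 2) Unit R S) (SR (DPIdx (Fin 2) Unit R S))}
    (hW : IsArchWeilDatum (ι𝕎 (Fin 2) Unit R S) ω) {e : VacExponents}
    (hvac : ∀ k : DPK (Fin 2) Unit R S, ω (κ (Fin 2) Unit R S k) (hermitePi 0) = vacScalar e k • hermitePi 0)
    (y : U21) (T : (SR (DPIdx (Fin 2) Unit R S)) →L[ℝ] V) (Φ : SR (DPIdx (Fin 2) Unit R S)) (b₀ : Fin 2 → ℂ) :
    DifferentiableAt ℝ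
      (fun b : Fin 2 → ℂ => T (ω ((u21FrameEquiv (y * expP b), (1 : UForm R S)) : Ginf (Fin 2) Unit R S) Φ))
      b₀ :=
  (contDiffAt_weilDatum_mul_expP hW hvac y T Φ b₀).differentiableAt (by simp)

set_option backward.isDefEq.respectTransparency false in
/-- [folklore] **Consumer shape, `y`-free, global.** `b ↦ T (ω((u21FrameEquiv (expP b), 1)) Φ)` is `C^∞`
on all of `ℂ²` (the shape of the model layer's `IsWeaklyPDiff` binder at the pin `e = expP`, after any
continuous linear transport of the Schwartz model has been absorbed into `T`). -/
theorem contDiff_weilDatum_expP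
    {ω : Representation ℂ (Ginf (Fin 2) Unit R S) (SR (DPIdx (Fin 2) Unit R S))}
    (hW : IsArchWeilDatum (ι𝕎 (Fin 2) Unit R S) ω) {e : VacExponents}
    (hvac : ∀ k : DPK (Fin 2) Unit R S, ω (κ (Fin 2) Unit R S k) (hermitePi 0) = vacScalar e k • hermitePi 0)
    (T : (SR (DPIdx (Fin 2) Unit R S)) →L[ℝ] V) (Φ : SR (DPIdx (Fin 2) Unit R S)) :
    ContDiff ℝ ((⊤ : ℕ∞) : WithTop ℕ∞)
      (fun b : Fin 2 → ℂ => T (ω ((u21FrameEquiv (expP b), (1 : UForm R S)) : Ginf (Fin 2) Unit R S) Φ)) := by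
  refine contDiff_iff_contDiffAt.2 fun b₀ => ?_
  have h := contDiffAt_weilDatum_mul_expP hW hvac 1 T Φ b₀
  simp only [one_mul] at h
  exact h

set_option backward.isDefEq.respectTransparency false in
/-- [folklore] **Consumer shape, `y`-free, first order.** `b ↦ T (ω((u21FrameEquiv (expP b), 1)) Φ)` is
real-Fréchet-differentiable at every `b₀` (in particular at `b₀ = 0`). -/
theorem differentiableAt_weilDatum_expP
    {ω : Representation ℂ (Ginf (Fin 2) Unit R S) (SR (DPIdx (Fin 2) Unit R S))}
    (hW : IsArchWeilDatum (ι𝕎 (Fin 2) Unit R S) ω) {e : VacExponents}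
    (hvac : ∀ k : DPK (Fin 2) Unit R S, ω (κ (Fin 2) Unit R S k) (hermitePi 0) = vacScalar e k • hermitePi 0)
    (T : (SR (DPIdx (Fin 2) Unit R S)) →L[ℝ] V) (Φ : SR (DPIdx (Fin 2) Unit R S)) (b₀ : Fin 2 → ℂ) :
    DifferentiableAt ℝ
      (fun b : Fin 2 → ℂ => T (ω ((u21FrameEquiv (expP b), (1 : UForm R S)) : Ginf (Fin 2) Unit R S) Φ)) b₀ :=
  (contDiff_weilDatum_expP hW hvac T Φ).contDiffAt.differentiableAt (by simp)

end Main

end RealDualPair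

end Literature.RepresentationTheory.KonnoKonno2007
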